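import Mathlib
import HarnessLib
import Literature.MathematicalPhysics.KineticTheory.HardSphereCrossSection

/-!
# Two replicas: the Gaussian ratio law is Cauchy — `(N(0,1) ⊗ N(0,1)){|x| ≤ q |y|} = (2/π)·arctan q`, so the `R = 2` replica-`t` bar has limiting coverage `(2/π)·arctan q` and is calibrated by `q = tan(π(1 − α)/2)`

HONEST FRAMING: exact (Metropolis-corrected) sampling algorithms for lattice gauge theory;
figures of merit are autocorrelation/cost numbers at stated couplings and volumes; no
continuum-physics claim.

Venture `LatticeQCDFlow` (cell pub-lqcd), topic `Exactness`; FANOUT row 13 (`eng-snf`, GEN-24).  NEW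
WORK of the cell against Mathlib (`lintegral_comp_polarCoord_symm`, `prod_withDensity`,
`gaussianReal_of_var_ne_zero`, `lintegral_prod_mul`, `Real.strictMonoOn_tan`, `Real.tan_arctan`) and the
tree's `Literature.MathematicalPhysics.KineticTheory.integral_mul_exp_neg_sq_half`
(`∫₀^∞ r e^{−r²/2} dr = 1`, folklore); not a published result (the Cauchy law of a ratio of
independent centred normals and Student's `t₁` are NAMED ONLY); no definition is introduced.

WHY (row 13).  GEN-23/24 showed that the engine's replica-jackknife / `target_means` /
"independent runs" error bar over `R` replicas, read with a quantile `q`, has ONE limiting coverage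
`L_R(q) = N(0,1)^{⊗R}{|t| ≤ q}` (K3/K4/I), and GEN-24 `NCMCGeneralSpaceReplicaTStatisticStudent`
identified `L_R(q) = N(0,1)^{⊗R}{z | |z_{r₀}| ≤ q √((Σ_{r ≠ r₀} z_r²)/(R−1))}`.  For `R = 2` — the
smallest and a common replica count (two streams / forward–reverse launch pairs) — that is
`(N(0,1) ⊗ N(0,1)){|x| ≤ q |y|}`, computed here in closed form by polar coordinates:
`(2/π)·arctan q`.  Consequences a user can read off: with the normal quantile the two-replica bar
under-covers by a fixed computable amount (`(2/π)·arctan 1.96 < 0.71`, not `0.95`), and the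
calibrating quantile of GEN-23 K5/K6 is `q = tan(π(1 − α)/2)` (`= 12.706…` at `α = 0.05`, Student's
`t₁` quantile — unnamed in Mathlib).

## Content
* `abs_cos_le_mul_abs_sin_iff` (§1) — for `θ ∈ (−π, π)`, `q ≥ 0`:
  `|cos θ| ≤ q |sin θ| ↔ ||θ| − π/2| ≤ arctan q`.
* `volume_setOf_abs_cos_le_mul_abs_sin` (§1) — the angular set has length `4·arctan q` in `(−π, π)`.
* **`gaussianReal_prod_measure_abs_le_mul_abs`** (§2) — `q ≥ 0`:
  `(N(0,1) ⊗ N(0,1)){p | |p.1| ≤ q |p.2|} = (2/π)·arctan q`.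
* **`gaussianReal_prod_measure_abs_le_mul_abs_tan`** (§2) — `α ∈ (0,1)`:
  the quantile `q = tan(π(1 − α)/2)` gives exactly `1 − α`;
  `gaussianReal_prod_measure_abs_le_two_mul_abs_lt` — with `q = 2 ≥ 1.96` the probability is `< 0.72`.

NOT CLAIMED: `R ≥ 3` closed forms (Student densities); the identification with the replica limit
`L_2` is one rewrite away (`NCMCGeneralSpaceReplicaTStatisticStudent` §3 with `card ι = 2`) and is
filed separately once that module has an olean; anything numerical beyond the displayed constants.
-/

namespace Summit.Ventures.LatticeQCDFlow.Exactness.GeneralNCMC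

open MeasureTheory ProbabilityTheory Set Filter Topology Real
open scoped ENNReal NNReal Topology

/-! ## §1 The angular set `{θ | |cos θ| ≤ q |sin θ|}` -/

section Angular

/-- For `ψ ∈ (−π/2, π/2)` and `q ≥ 0`: `|sin ψ| ≤ q cos ψ ↔ |ψ| ≤ arctan q`. -/
theorem abs_sin_le_mul_cos_iff {ψ : ℝ} (hψ : ψ ∈ Ioo (-(π / 2)) (π / 2)) (q : ℝ) :
    |sin ψ| ≤ q * cos ψ ↔ |ψ| ≤ arctan q := by
  have hcos : 0 < cos ψ := cos_pos_of_mem_Ioo hψ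
  -- `|sin ψ| ≤ q cos ψ ↔ |tan ψ| ≤ q`
  have h1 : |sin ψ| ≤ q * cos ψ ↔ |tan ψ| ≤ q := by
    rw [tan_eq_sin_div_cos, abs_div, abs_of_pos hcos, div_le_iff₀ hcos]
  -- `|tan ψ| = tan |ψ|`
  have h2 : |tan ψ| = tan |ψ| := by
    rcases le_or_gt 0 ψ with h | h
    · rw [abs_of_nonneg h, abs_of_nonneg (tan_nonneg_of_nonneg_of_le_pi_div_two h hψ.2.le)]
    · rw [abs_of_neg h, tan_neg, abs_of_nonpos
        (tan_nonpos_of_nonpos_of_neg_pi_div_two_le h.le hψ.1.le)]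
  have habs : |ψ| ∈ Ioo (-(π / 2)) (π / 2) :=
    ⟨by linarith [abs_nonneg ψ, pi_pos], abs_lt.2 ⟨hψ.1, hψ.2⟩⟩
  have harc : arctan q ∈ Ioo (-(π / 2)) (π / 2) :=
    ⟨neg_pi_div_two_lt_arctan q, arctan_lt_pi_div_two q⟩
  rw [h1, h2, ← strictMonoOn_tan.le_iff_le habs harc, tan_arctan]

/-- **The angular condition in closed form**: for `θ ∈ (−π, π)` and `q ≥ 0`,
`|cos θ| ≤ q |sin θ| ↔ ||θ| − π/2| ≤ arctan q`
(`|cos θ| = |sin(|θ| − π/2)|`, `|sin θ| = cos(|θ| − π/2)`). -/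
theorem abs_cos_le_mul_abs_sin_iff {θ : ℝ} (hθ : θ ∈ Ioo (-π) π) (q : ℝ) :
    |cos θ| ≤ q * |sin θ| ↔ |(|θ| - π / 2)| ≤ arctan q := by
  have hθabs : |θ| < π := abs_lt.2 ⟨hθ.1, hθ.2⟩
  -- `|sin θ| = sin |θ|`
  have hsin : |sin θ| = sin |θ| := by
    rcases le_or_gt 0 θ with h | h
    · rw [abs_of_nonneg h, abs_of_nonneg (sin_nonneg_of_nonneg_of_le_pi h hθ.2.le)]
    · rw [abs_of_neg h, sin_neg, abs_of_nonpos (sin_nonpos_of_nonpos_of_neg_pi_le h.le hθ.1.le)]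
  have hcosθ : cos θ = -sin (|θ| - π / 2) := by
    rw [← cos_abs θ]
    conv_lhs => rw [show |θ| = (|θ| - π / 2) + π / 2 by ring]
    rw [cos_add_pi_div_two]
  have hsinθ : |sin θ| = cos (|θ| - π / 2) := by
    rw [hsin]
    conv_lhs => rw [show |θ| = (|θ| - π / 2) + π / 2 by ring]
    rw [sin_add_pi_div_two]
  rw [hcosθ, abs_neg, hsinθ]
  -- the degenerate point `θ = 0` (`ψ = −π/2`): both sides are false
  rcases eq_or_ne θ 0 with h0 | h0
  · subst h0
    simp only [abs_zero, zero_sub, sin_neg, abs_neg, cos_neg, sin_pi_div_two, cos_pi_div_two,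
      abs_one, mul_zero]
    constructor
    · intro h; linarith
    · intro h; linarith [arctan_lt_pi_div_two q, abs_nonneg (π / 2), pi_pos,
        show |π / 2| = π / 2 from abs_of_pos (by positivity)]
  · have hψ : |θ| - π / 2 ∈ Ioo (-(π / 2)) (π / 2) :=
      ⟨by linarith [abs_pos.2 h0], by linarith⟩
    exact abs_sin_le_mul_cos_iff hψ q

/-- The angular set inside `(−π, π)` is the union of two intervals of length `2·arctan q`. -/
theorem setOf_abs_cos_le_mul_abs_sin_inter_Ioo {q : ℝ} (hq : 0 ≤ q) :
    {θ : ℝ | |cos θ| ≤ q * |sin θ|} ∩ Ioo (-π) π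
      = Icc (π / 2 - arctan q) (π / 2 + arctan q)
        ∪ Icc (-(π / 2 + arctan q)) (-(π / 2 - arctan q)) := by
  have hα1 : 0 ≤ arctan q := arctan_nonneg.2 hq
  have hα2 : arctan q < π / 2 := arctan_lt_pi_div_two q
  ext θ
  simp only [mem_inter_iff, mem_setOf_eq, mem_union, mem_Icc, mem_Ioo]
  constructor
  · rintro ⟨h, hθ⟩
    rw [abs_cos_le_mul_abs_sin_iff hθ q, abs_le] at h
    rcases le_or_gt 0 θ with h0 | h0
    · rw [abs_of_nonneg h0] at h
      left; constructor <;> linarith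
    · rw [abs_of_neg h0] at h
      right; constructor <;> linarith
  · intro h
    have hθ : θ ∈ Ioo (-π) π := by
      rcases h with h | h <;> (constructor <;> linarith)
    refine ⟨?_, hθ⟩
    rw [abs_cos_le_mul_abs_sin_iff hθ q, abs_le]
    rcases h with h | h
    · rw [abs_of_nonneg (by linarith : (0 : ℝ) ≤ θ)]
      constructor <;> linarith
    · rw [abs_of_neg (by linarith : θ < 0)]
      constructor <;> linarith

/-- **`vol({θ ∈ (−π, π) | |cos θ| ≤ q |sin θ|}) = 4·arctan q`** (`q ≥ 0`). -/
theorem volume_setOf_abs_cos_le_mul_abs_sin {q : ℝ} (hq : 0 ≤ q) :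
    volume ({θ : ℝ | |cos θ| ≤ q * |sin θ|} ∩ Ioo (-π) π) = ENNReal.ofReal (4 * arctan q) := by
  have hα1 : 0 ≤ arctan q := arctan_nonneg.2 hq
  have hα2 : arctan q < π / 2 := arctan_lt_pi_div_two q
  rw [setOf_abs_cos_le_mul_abs_sin_inter_Ioo hq,
    measure_union _ measurableSet_Icc, Real.volume_Icc, Real.volume_Icc,
    ← ENNReal.ofReal_add (by linarith) (by linarith)]
  · congr 1
    ring
  · rw [Set.disjoint_iff]
    rintro θ ⟨h1, h2⟩
    simp only [mem_Icc] at h1 h2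
    linarith

end Angular

/-! ## §2 The Gaussian measure of the double cone `{|x| ≤ q |y|}` -/

section Cone

/-- **`(N(0,1) ⊗ N(0,1)){p | |p.1| ≤ q |p.2|} = (2/π)·arctan q`** for `q ≥ 0` — the symmetric
Cauchy probability (polar coordinates: the density `e^{−r²/2}/(2π)` is radial, the event is the
angular set of §1 of length `4·arctan q`, and `∫₀^∞ r e^{−r²/2} dr = 1`). -/
theorem gaussianReal_prod_measure_abs_le_mul_abs {q : ℝ} (hq : 0 ≤ q) :
    ((gaussianReal 0 1).prod (gaussianReal 0 1)) {p : ℝ × ℝ | |p.1| ≤ q * |p.2|}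
      = ENNReal.ofReal (2 / π * arctan q) := by
  have hA : MeasurableSet {p : ℝ × ℝ | |p.1| ≤ q * |p.2|} :=
    measurableSet_le (measurable_fst.abs) ((measurable_snd.abs).const_mul q)
  have hpdf : Measurable (gaussianPDF 0 1) := measurable_gaussianPDF 0 1
  -- density form on `ℝ × ℝ`
  rw [gaussianReal_of_var_ne_zero 0 one_ne_zero, prod_withDensity hpdf hpdf,
    ← Measure.volume_eq_prod, withDensity_apply _ hA, ← lintegral_indicator hA,
    ← lintegral_comp_polarCoord_symm]
  -- the integrand in polar coordinates, on the target `(0,∞) × (−π,π)`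
  have hΘ : MeasurableSet {θ : ℝ | |cos θ| ≤ q * |sin θ|} :=
    measurableSet_le continuous_cos.measurable.abs (continuous_sin.measurable.abs.const_mul q)
  have heq : ∀ p ∈ polarCoord.target,
      ENNReal.ofReal p.1 • ({p : ℝ × ℝ | |p.1| ≤ q * |p.2|}.indicator
        (fun z : ℝ × ℝ => gaussianPDF 0 1 z.1 * gaussianPDF 0 1 z.2) (polarCoord.symm p))
      = ENNReal.ofReal (1 / (2 * π)) * ENNReal.ofReal (p.1 * rexp (-p.1 ^ 2 / 2))
          * {θ : ℝ | |cos θ| ≤ q * |sin θ|}.indicator 1 p.2 := by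
    rintro ⟨r, θ⟩ hp
    simp only [polarCoord_target, mem_prod, mem_Ioi, mem_Ioo] at hp
    have hr : 0 < r := hp.1
    simp only [polarCoord_symm_apply, smul_eq_mul]
    -- membership of `(r cos θ, r sin θ)` in the cone is the angular condition
    have hmem : ((r * cos θ, r * sin θ) ∈ {p : ℝ × ℝ | |p.1| ≤ q * |p.2|})
        ↔ θ ∈ {θ : ℝ | |cos θ| ≤ q * |sin θ|} := by
      simp only [mem_setOf_eq, abs_mul, abs_of_pos hr]
      rw [show q * (r * |sin θ|) = r * (q * |sin θ|) by ring]
      exact mul_le_mul_iff_right₀ hr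
    -- the density at `(r cos θ, r sin θ)` is `e^{−r²/2}/(2π)`
    have hdens : gaussianPDF 0 1 (r * cos θ) * gaussianPDF 0 1 (r * sin θ)
        = ENNReal.ofReal (1 / (2 * π)) * ENNReal.ofReal (rexp (-r ^ 2 / 2)) := by
      rw [gaussianPDF, gaussianPDF, gaussianPDFReal, gaussianPDFReal,
        ← ENNReal.ofReal_mul (by positivity), ← ENNReal.ofReal_mul (by positivity)]
      congr 1
      have hc : (r * cos θ - 0) ^ 2 / (2 * ((1 : ℝ≥0) : ℝ))
          + (r * sin θ - 0) ^ 2 / (2 * ((1 : ℝ≥0) : ℝ)) = r ^ 2 / 2 := by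
        have := sin_sq_add_cos_sq θ
        simp only [NNReal.coe_one, mul_one, sub_zero]
        nlinarith [this]
      rw [show (Real.sqrt (2 * π * ((1 : ℝ≥0) : ℝ)))⁻¹
            * rexp (-(r * cos θ - 0) ^ 2 / (2 * ((1 : ℝ≥0) : ℝ)))
          * ((Real.sqrt (2 * π * ((1 : ℝ≥0) : ℝ)))⁻¹
            * rexp (-(r * sin θ - 0) ^ 2 / (2 * ((1 : ℝ≥0) : ℝ))))
          = ((Real.sqrt (2 * π * ((1 : ℝ≥0) : ℝ)))⁻¹ * (Real.sqrt (2 * π * ((1 : ℝ≥0) : ℝ)))⁻¹)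
            * (rexp (-(r * cos θ - 0) ^ 2 / (2 * ((1 : ℝ≥0) : ℝ)))
              * rexp (-(r * sin θ - 0) ^ 2 / (2 * ((1 : ℝ≥0) : ℝ)))) by ring,
        ← Real.exp_add, ← mul_inv, Real.mul_self_sqrt (by positivity)]
      congr 1
      · simp
      · congr 1
        rw [neg_div, neg_div, ← neg_add, hc, neg_div]
    by_cases hθ : θ ∈ {θ : ℝ | |cos θ| ≤ q * |sin θ|}
    · rw [indicator_of_mem (hmem.2 hθ), indicator_of_mem hθ, hdens]
      simp only [Pi.one_apply, mul_one]
      rw [ENNReal.ofReal_mul hr.le]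
      ring
    · rw [indicator_of_notMem (fun h => hθ (hmem.1 h)), indicator_of_notMem hθ]
      simp
  rw [setLIntegral_congr_fun polarCoord.open_target.measurableSet heq]
  -- the radial factor: `∫₀^∞ r e^{−r²/2} dr = 1` (Literature `integral_mul_exp_neg_sq_half`)
  have hrad : ∫⁻ r in Ioi (0 : ℝ), ENNReal.ofReal (r * rexp (-r ^ 2 / 2)) = 1 := by
    have hint : IntegrableOn (fun x => x * rexp (-x ^ 2 / 2)) (Ioi 0) := by
      have := (integrable_mul_exp_neg_mul_sq (b := 1 / 2) (by norm_num)).integrableOn (s := Ioi 0)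
      refine this.congr_fun (fun x _ => ?_) measurableSet_Ioi
      simp only
      congr 2
      ring
    rw [← ofReal_integral_eq_lintegral_ofReal hint,
      Literature.MathematicalPhysics.KineticTheory.integral_mul_exp_neg_sq_half, ENNReal.ofReal_one]
    filter_upwards [ae_restrict_mem measurableSet_Ioi] with r hr
    exact mul_nonneg (le_of_lt hr) (exp_pos _).le
  -- split the product integral
  rw [polarCoord_target, Measure.volume_eq_prod, ← Measure.prod_restrict]
  have hf : Measurable fun r : ℝ =>
      ENNReal.ofReal (1 / (2 * π)) * ENNReal.ofReal (r * rexp (-r ^ 2 / 2)) := by fun_prop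
  have hg : Measurable fun θ : ℝ => ({θ : ℝ | |cos θ| ≤ q * |sin θ|}.indicator 1 θ : ℝ≥0∞) :=
    measurable_one.indicator hΘ
  rw [lintegral_prod_mul (f := fun r : ℝ =>
      ENNReal.ofReal (1 / (2 * π)) * ENNReal.ofReal (r * rexp (-r ^ 2 / 2)))
      (g := fun θ : ℝ => ({θ : ℝ | |cos θ| ≤ q * |sin θ|}.indicator 1 θ : ℝ≥0∞))
      hf.aemeasurable hg.aemeasurable,
    lintegral_const_mul _ (by fun_prop), hrad, mul_one,
    lintegral_indicator_one hΘ, Measure.restrict_apply hΘ,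
    volume_setOf_abs_cos_le_mul_abs_sin hq, ← ENNReal.ofReal_mul (by positivity)]
  congr 1
  field_simp
  ring

/-- **Calibration for two replicas**: for `α ∈ (0, 1)` the quantile `q = tan(π(1 − α)/2)` gives
`(N(0,1) ⊗ N(0,1)){|x| ≤ q |y|} = 1 − α` exactly (`q ≈ 12.706` at `α = 0.05`: Student's `t₁`
two-sided quantile, unnamed). -/
theorem gaussianReal_prod_measure_abs_le_mul_abs_tan {α : ℝ} (hα : α ∈ Ioo (0 : ℝ) 1) :
    ((gaussianReal 0 1).prod (gaussianReal 0 1))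
        {p : ℝ × ℝ | |p.1| ≤ tan (π * (1 - α) / 2) * |p.2|}
      = ENNReal.ofReal (1 - α) := by
  have h1 : 0 < π * (1 - α) / 2 := by have := hα.2; positivity
  have h1' : 0 ≤ π * (1 - α) / 2 := h1.le
  have h2 : π * (1 - α) / 2 < π / 2 := by nlinarith [hα.1, pi_pos]
  have hq : 0 ≤ tan (π * (1 - α) / 2) := tan_nonneg_of_nonneg_of_le_pi_div_two h1' h2.le
  rw [gaussianReal_prod_measure_abs_le_mul_abs hq,
    arctan_tan (by linarith) h2]
  congr 1
  field_simp

/-- With the NORMAL two-sided 95 % quantile (`1.96 ≤ 2`) two replicas cover with limiting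
probability `≤ (2/π)·arctan 2 < 0.72` — a fixed, computable under-coverage
(`arctan 2 = π/4 + arctan(1/3)` by Mathlib's `arctan 2⁻¹ + arctan 3⁻¹ = π/4`, and
`arctan(1/3) < 1/3`). -/
theorem gaussianReal_prod_measure_abs_le_two_mul_abs_lt :
    ((gaussianReal 0 1).prod (gaussianReal 0 1)) {p : ℝ × ℝ | |p.1| ≤ 2 * |p.2|}
      < ENNReal.ofReal 0.72 := by
  rw [gaussianReal_prod_measure_abs_le_mul_abs (by norm_num : (0 : ℝ) ≤ 2)]
  refine (ENNReal.ofReal_lt_ofReal_iff_of_nonneg (by positivity)).2 ?_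
  have h3pos : 0 < arctan (3⁻¹ : ℝ) := arctan_pos.2 (by norm_num)
  have h3 : arctan (3⁻¹ : ℝ) < 3⁻¹ := by
    have h := Real.lt_tan h3pos (arctan_lt_pi_div_two _)
    rwa [tan_arctan] at h
  have h2 : arctan (2 : ℝ) = π / 4 + arctan 3⁻¹ := by
    have ha : arctan ((2⁻¹ : ℝ)⁻¹) = π / 2 - arctan 2⁻¹ := arctan_inv_of_pos (by norm_num)
    rw [inv_inv] at ha
    have hb := arctan_inv_2_add_arctan_inv_3
    linarith
  have hπ : (3.1415 : ℝ) < π := pi_gt_d4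
  rw [h2, div_mul_eq_mul_div, div_lt_iff₀ pi_pos]
  nlinarith

end Cone

end Summit.Ventures.LatticeQCDFlow.Exactness.GeneralNCMC
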